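import Literature.Computability.QuantumComplexity.ZWCalculus
import HarnessLib

/-!
# The two parts of the completeness proof of `ZX_{π/4}` (Jeandel–Perdrix–Vilmart 2018, §3) and
# the decomposition of `JeandelPerdrixVilmart2018_completeness`

Topic `Literature/Computability/QuantumComplexity`. Fact decomposition (librarian, mode
`fact-decompose`, 2026-08-16) of the XL named fact
`Literature.Computability.QuantumComplexity.JeandelPerdrixVilmart2018_completeness`
(`ZXCalculus.lean`; E. Jeandel, S. Perdrix, R. Vilmart, LICS 2018, Thm. 1: two `ZX_{π/4}`-diagrams
with the same standard interpretation are inter-derivable).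

The printed proof is the chain of §3 "A Bird's Eye View of the Proof of Theorem 1" (read:
arXiv:1705.11151v2, pp. 5–6, 8–11):

* **Part 1** (Prop. 1, §4.3): `ZW_{1/2}` is complete — CHILD 1 `ZWHalf_completeness`;
* **Parts 2–4** (Prop. 5, §5; Prop. 7, §6; Prop. 8 and Cor. 1, §7): there is an interpretation
  `[·]_XW` of `ZX_{π/4}`-diagrams of type `k → l` as `ZW_{1/2}`-diagrams of type `k + 2 → l + 2`
  ("every complex coefficient will be represented by a `4 × 4` matrix with dyadic rational
  coefficients", the two control wires carrying `ψ(e^{iπ/4}) = M`) with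
  `⟦D₁⟧ = ⟦D₂⟧ ⇒ ⟦[D₁]_XW⟧ = ⟦[D₂]_XW⟧` (Part 2) and, through the converse interpretation
  `[·]_WX` (Part 3: it preserves semantics and provability) and the recovery of `D` from
  `[[D]_XW]_WX` (Part 4), `ZW_{1/2} ⊢ [D₁]_XW = [D₂]_XW ⇒ ZX_{π/4} ⊢ D₁ = D₂` — CHILD 2
  `ZXtoZW_soundEncoding_reflectsProvability`, stated as the existence of such an encoding (the
  translations themselves are being built by the parent's seat: `ZXCalculusTriangleNode.lean`,
  `ZXCalculusTriangleLemmas.lean`, …, and `ZWCalculus.lean`);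
* ASSEMBLY `JeandelPerdrixVilmart2018_completeness_holds_of` (PROVED: the four-line "Proof of
  Theorem 1" of §3).

Neither child restates the parent (child 1 is about another calculus; child 2 asserts an encoding
into it), and both are strictly intermediate results of the printed proof.

## References

* E. Jeandel, S. Perdrix, R. Vilmart, *A complete axiomatisation of the ZX-calculus for
  Clifford+T quantum mechanics*, LICS 2018 (arXiv:1705.11151v2), Thm. 1, §3 (Parts 1–4), Prop. 1
  (§4.3), Def. 2 and Prop. 5 (§5), Props. 6–7 (§6), Prop. 8 and Cor. 1 (§7).
  [JeandelPerdrixVilmart2018]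
* A. Hadzihasanovic, *A diagrammatic axiomatisation for qubit entanglement*, LICS 2015
  (arXiv:1501.07082), Thm. (completeness of ZW). [Hadzihasanovic2015]
-/

noncomputable section

namespace Literature.Computability.QuantumComplexity

/-- NAMED FACT (split child 1 of `JeandelPerdrixVilmart2018_completeness`) — **`ZW_{1/2}` is
complete** (Jeandel–Perdrix–Vilmart 2018, Prop. 1 = Part 1 of §3: "for two diagrams `D₁, D₂` of
the `ZW_{1/2}`-calculus, `⟦D₁⟧ = ⟦D₂⟧` iff `ZW_{1/2} ⊢ D₁ = D₂`", the non-trivial direction; proved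
in print from Hadzihasanovic's completeness of ZW for integer matrices by clearing the symbolic
inverse `½` of `2`). Stated for the term calculus `ZWDiagram` / `ZWhEquivalent` of `ZWCalculus.lean`.
[cite: JeandelPerdrixVilmart2018, Prop. 1 (§4.3)] [cite: Hadzihasanovic2015, Thm. (completeness)] -/
def ZWHalf_completeness : Prop :=
  ∀ (n m : ℕ) (D₁ D₂ : ZWDiagram n m), D₁.interp = D₂.interp → ZWhEquivalent D₁ D₂

/-- NAMED FACT (split child 2 of `JeandelPerdrixVilmart2018_completeness`) — **the encoding of
`ZX_{π/4}` into `ZW_{1/2}` is sound on interpretations and reflects provability** (Jeandel–Perdrix–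
Vilmart 2018, Parts 2–4 of §3): there is a map `[·]_XW` from `ZX_{π/4}`-diagrams of type `k → l` to
`ZW_{1/2}`-diagrams of type `k + 2 → l + 2` (§5, Def. 2 and the interpretation of the generators,
the two extra "control wires" encoding `ℤ[½][e^{iπ/4}]`-coefficients as `4 × 4` dyadic blocks via
`ψ`) such that (Prop. 5) `⟦D₁⟧ = ⟦D₂⟧ ⇒ ⟦[D₁]_XW⟧ = ⟦[D₂]_XW⟧`, and (Prop. 7 with Prop. 8 /
Cor. 1: `[·]_WX` preserves provability and `ZX_{π/4} ⊢ D = (…) ∘ [[D]_XW]_WX ∘ (…)`)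
`ZW_{1/2} ⊢ [D₁]_XW = [D₂]_XW ⇒ ZX_{π/4} ⊢ D₁ = D₂`. Stated as an existential over the encoding, for
the term calculi of `ZXCalculus.lean` / `ZWCalculus.lean`.
[cite: JeandelPerdrixVilmart2018, §3 Parts 2–4 (Prop. 5, Prop. 7, Prop. 8, Cor. 1)] -/
def ZXtoZW_soundEncoding_reflectsProvability : Prop :=
  ∃ enc : ∀ n m : ℕ, ZXDiagram n m → ZWDiagram (n + 2) (m + 2),
    (∀ (n m : ℕ) (D₁ D₂ : ZXDiagram n m), D₁.interp = D₂.interp →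
      (enc n m D₁).interp = (enc n m D₂).interp) ∧
    (∀ (n m : ℕ) (D₁ D₂ : ZXDiagram n m), ZWhEquivalent (enc n m D₁) (enc n m D₂) →
      ZXEquivalent D₁ D₂)

/-- ASSEMBLY of the split of `JeandelPerdrixVilmart2018_completeness` (PROVED) — the "Proof of
Theorem 1" of §3: `⟦D₁⟧ = ⟦D₂⟧` ⟹ (Part 2) `⟦[D₁]_XW⟧ = ⟦[D₂]_XW⟧` ⟹ (Part 1)
`ZW_{1/2} ⊢ [D₁]_XW = [D₂]_XW` ⟹ (Parts 3–4) `ZX_{π/4} ⊢ D₁ = D₂`.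
[cite: JeandelPerdrixVilmart2018, Thm. 1 (proof, §3)] -/
theorem JeandelPerdrixVilmart2018_completeness_holds_of (h₁ : ZWHalf_completeness)
    (h₂ : ZXtoZW_soundEncoding_reflectsProvability) : JeandelPerdrixVilmart2018_completeness := by
  intro n m D₁ D₂ h
  obtain ⟨enc, hsound, hreflect⟩ := h₂
  exact hreflect n m D₁ D₂ (h₁ _ _ _ _ (hsound n m D₁ D₂ h))

end Literature.Computability.QuantumComplexity

end
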